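import Summits.HodgeConjecture.HodgeConjecture.Theorems.F0P2oLineWeilDictionaryFrameTransport  -- ★ p836339 A-p01 (g19): `transpose_pairFrame_mul_gram_mul_pairFrame` ((PE) at ONE enumeration), `gram`, `reindexGL`, `kroneckerGL`
import Summits.HodgeConjecture.HodgeConjecture.Theorems.F0P2oBlockAdaptedCongruence          -- ★ p837182 A-p16 (g24): `realDiagonal_eq_finSum` (the CM block datum `diag(dV′₀) ⊕ᶠ diag(dV′₁, dV′₂)`)
import Literature.NumberTheory.GelbartRogawski1991.LocalSplittingCMGaloisTransport            -- ★ `gram_diagonal_TW` (the pair Gram of `diag(d) ⊗ ⟨a⟩` is diagonal)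
import Literature.NumberTheory.Automorphic.HeckeTransversalGL                                 -- ★ `permGL`, `coe_permGL` (permutation matrices in `GL_n`)
import HarnessLib

/-!
# Crux `H413` — N3 ROAD (a), row (β): (PE)+(BD) GRAM BOOKKEEPING OF THE BLOCK FRAME

F0∕P2, cell `hodgecm-mathlib` (D-0151), crux item `stmt-HodgeConjecture-24833` (binder h413), programme P2, N3 road (a) of the K1 lead
B-p18 (g29) (dealing 2026-08-31T23:08:02Z (β) + refinement 23:08:41Z); seat B-p08 (g25).  THEOREMS ONLY (no `def`, no instance, no notation,
no named fact, no `sorry`); kernel lane `--supports stmt-HodgeConjecture-24833 --as helper`.  HONEST LABEL: HC_CM is proved only modulo the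
2 remaining named inputs (hLiu418, h413) — behind them the booked printed statements + the MOD package — until rung 0 closes; this file proves
NO letter: it is matrix bookkeeping for the (a)-side assembler of N3 #96 (`GelbartRogawski1991.thetaType_nonsplit_jacquetModule`).

THE SETTING [GelbartRogawski1991 §3.1 p. 454; §3.2 p. 457].  The CM dual pair `U(V) × U(W)`, `V = diag(dV)` (`dV : Fin 3 → L` real, non-zero), `W = ⟨ε⟩`
a hermitian LINE, is read in the tree through the pair Gram matrix ★ `UnitaryDualPair.gram L⁺ e T_V T_W := reindex e e (T_V ⊗ₖ T_W)` along an
ENUMERATION `e : Fin 3 × Fin 1 ≃ Fin n′` (★ `chiLocalSplittingsCM L e dV …`, ★ `localLineInl … e …`).  The N3 letter quantifies over an arbitrary `e₁`;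
the block frame of the (a)-road (★ (F′) `exists_rational_hyperbolic_realDiagonal_frame`, ★ (BF) `exists_blockAdaptedCongr`) works at the standard
enumeration `pU₃ := Equiv.prodUnique (Fin 3) (Fin 1)` where the pair Gram of the block datum `dV′ = (dV′₀ ∣ dV′₁, dV′₂)` must be RECOGNISED as the
block sum `T₁ ⊕ᶠ T₂` (★ `UnitaryGroup.finSum`) that the local see-saw ★ (LS) `DoubledBlock.toRep_localSplittingCMWith_inlLoc_boxSB_of_eq` and the
chart factorisation (C4) ★ `F0P2oBlockFrameChartFactorisation.exists_fibre_boxSB_eq_smul_blockFrame` take as their hypothesis `hTsum`.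

§1 GENERIC (`F` any field).  (PE) THE PERMUTATION FRAME between two enumerations `e, e′ : Fin N × Fin M ≃ Fin n`: `gram e′ = reindex σ σ (gram e)`,
`σ := e⁻¹ ∘ e′` (`gram_eq_reindex_gram`); `P_σᵀ · A · P_σ = reindex σ σ A` for the permutation matrix ★ `permGL σ` (`transpose_permGL_mul_mul_permGL`);
hence `P_σᵀ · gram e T_V T_W · P_σ = gram e′ T_V T_W` (`transpose_permFrame_mul_gram_mul_permFrame`) and, composed with A-p01's ★ pair frame
`reindexGL e (Q ⊗ 1)` (`Qᵀ T Q = T′`), the TWO-ENUMERATION pair frame `(reindexGL e (Q ⊗ 1) · P_σ)ᵀ · gram e T T_W · (…) = gram e′ T′ T_W`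
(`transpose_pairPermFrame_mul_gram_mul_pairPermFrame`) — the `hP` that (U) ★ `frameOp_toRep_localSplittingCMWith` wants to carry the CM Weil package from
the letter's `(dV, e₁)` to the block frame `(dV′, pU₃)` in ONE application.  (BD-gen) at the standard enumeration the pair Gram of `T_V ⊗ ⟨t⟩` is `t • T_V`
(`gram_prodUnique`), so it commutes with block sums: `gram pU (T₁ ⊕ᶠ T₂) T_W = gram pU T₁ T_W ⊕ᶠ gram pU T₂ T_W` (`gram_prodUnique_finSum`).
§2 CM.  (BD) `gram pU₃ (realDiagonal dV′) (ε) = gram pU₁ (realDiagonal (dV′₀)) (ε) ⊕ᶠ gram pU₂ (realDiagonal (dV′₁, dV′₂)) (ε)` (`gram_prodUnique_realDiagonal_eq_finSum`,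
over A-p16's ★ `realDiagonal_eq_finSum`) — the `hTsum` of (LS)∕(C4)∕(C5) with the line block `T₁` EQUAL to the Gram on which ★ `lineWeilCM L pU₁ (fun _ => dV′ 0) …`
lives; the block facts (`T₁` diagonal — the `hT₁t` of (LS) —, `T₁`, `T₂` symmetric with unit determinant); and the ∃-form (PE∃) `exists_pairFrame` of the
lead's refinement, verbatim.  §3 (BD-G) THE GROUP SQUARE at the block frame: `localLineInl_{pU₃} ∘ inlLoc^{V} = inlLoc^{V ⊗ W} ∘ localLineInl_{pU₁}` on
`U(diag(dV′₀))(L⁺_v)` — the step «`ch t = BlockSum.inlLoc … β̃`» of (C5) between ★ (BF)(i) (V-level `inlLoc`) and ★ (LS) (pair-level `inlLoc`), no cast.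

## References
* [GelbartRogawski1991] S. Gelbart, J. Rogawski, *L-functions and Fourier–Jacobi coefficients for the unitary group U(3)*, Invent. Math. 105 (1991): §3.1 p. 454; §3.2 p. 457.
* [Kudla1984] S. Kudla, *Seesaw dual reductive pairs*, Progr. Math. 46 (1984): §1.  [Kudla1994] S. Kudla, Israel J. Math. 87 (1994): §3 Thm. 3.1.
* [MoeglinVignerasWaldspurger1987] C. Mœglin, M.-F. Vignéras, J.-L. Waldspurger, LNM 1291 (1987): Chap. 1 I.17; Chap. 2 II Remarque (3).
-/

set_option autoImplicit false
-- the mandated namespace has the single-problem summit's repeated segment (`HodgeConjecture.HodgeConjecture`)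
set_option linter.dupNamespace false

noncomputable section

open NumberField IsDedekindDomain
open scoped Matrix Kronecker

open Literature.NumberTheory Literature.NumberTheory.Automorphic Literature.NumberTheory.Automorphic.UnitaryGroup
open Literature.NumberTheory.Automorphic.Liu2021 Literature.NumberTheory.Automorphic.Liu2021.Def411WeilCarriers
open Literature.NumberTheory.GelbartRogawski1991 Literature.NumberTheory.GelbartRogawski1991.UnitaryDualPair
open Literature.NumberTheory.GelbartRogawski1991.UnitaryDualPair.LocalSplitting

open Summit.HodgeConjecture.HodgeConjecture.Cruxes.H413.F0P2oLineWeilDictionaryFrameTransport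
open Summit.HodgeConjecture.HodgeConjecture.Cruxes.H413.F0P2oBlockAdaptedCongruence

namespace Summit.HodgeConjecture.HodgeConjecture.Cruxes.H413.F0P2oCMBlockFrameGram

/-! ## §1 Generic Gram bookkeeping: the permutation frame between two enumerations; the standard enumeration and block sums -/

section Generic

variable (F : Type) [Field F] {N M n : ℕ}

/-- **(PE) two enumerations differ by a relabelling**: `gram e′ T_V T_W = reindex σ σ (gram e T_V T_W)`, `σ := e⁻¹ ∘ e′` (both sides are
`(T_V ⊗ₖ T_W)` read at `e′⁻¹ i, e′⁻¹ j`). [cite: GelbartRogawski1991, §3.1 p. 454] -/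
theorem gram_eq_reindex_gram (e e' : Fin N × Fin M ≃ Fin n) (TV : Matrix (Fin N) (Fin N) F) (TW : Matrix (Fin M) (Fin M) F) :
    UnitaryDualPair.gram F e' TV TW = Matrix.reindex (e.symm.trans e') (e.symm.trans e') (UnitaryDualPair.gram F e TV TW) := by
  refine Matrix.ext fun i j => ?_
  simp only [UnitaryDualPair.gram, Matrix.reindex_apply, Matrix.submatrix_apply, Equiv.symm_trans_apply, Equiv.symm_symm,
    Equiv.symm_apply_apply]

/-- **`P_σᵀ · A · P_σ = reindex σ σ A`** for the permutation matrix ★ `permGL σ` (`(P_σ)_{ij} = [σ i = j]`, `P_σᵀ = P_{σ⁻¹}`): congruence by a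
permutation matrix is a relabelling of rows and columns. [cite: MoeglinVignerasWaldspurger1987, Chap. 1 I.17] -/
theorem transpose_permGL_mul_mul_permGL (σ : Equiv.Perm (Fin n)) (A : Matrix (Fin n) (Fin n) F) :
    ((permGL σ : GL (Fin n) F) : Matrix (Fin n) (Fin n) F)ᵀ * A * ((permGL σ : GL (Fin n) F) : Matrix (Fin n) (Fin n) F) =
      Matrix.reindex σ σ A := by
  rw [coe_permGL, Matrix.transpose_permMatrix, Equiv.Perm.permMatrix, Equiv.Perm.permMatrix, PEquiv.toMatrix_toPEquiv_mul,
    PEquiv.mul_toMatrix_toPEquiv, Matrix.reindex_apply, Matrix.submatrix_submatrix]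
  rfl

/-- **(PE) THE PERMUTATION FRAME**: `P_σᵀ · gram e T_V T_W · P_σ = gram e′ T_V T_W` for `σ = e⁻¹ ∘ e′` — the frame `permGL (e.symm.trans e′) ∈ GL_n(F)`
carries the pair Gram of one enumeration to that of the other (the `hP` of (U) ★ `frameOp_toRep_localSplittingCMWith` for a pure relabelling).
[cite: GelbartRogawski1991, §3.1 p. 454] [cite: MoeglinVignerasWaldspurger1987, Chap. 2 II Remarque (3)] -/
theorem transpose_permFrame_mul_gram_mul_permFrame (e e' : Fin N × Fin M ≃ Fin n) (TV : Matrix (Fin N) (Fin N) F) (TW : Matrix (Fin M) (Fin M) F) :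
    ((permGL (e.symm.trans e') : GL (Fin n) F) : Matrix (Fin n) (Fin n) F)ᵀ * UnitaryDualPair.gram F e TV TW *
        ((permGL (e.symm.trans e') : GL (Fin n) F) : Matrix (Fin n) (Fin n) F) = UnitaryDualPair.gram F e' TV TW := by
  rw [transpose_permGL_mul_mul_permGL, ← gram_eq_reindex_gram]

/-- **(PE₂) THE TWO-ENUMERATION PAIR FRAME**: for a rational frame `Q` of the hermitian space (`Qᵀ T Q = T′`) and two enumerations `e, e′` of `Fin N × Fin 1`,
the frame `Q_pair := reindexGL e (Q ⊗ 1) · P_{e⁻¹∘e′} ∈ GL_n(F)` satisfies `Q_pairᵀ · gram e T T_W · Q_pair = gram e′ T′ T_W` — ONE (U)-application from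
the letter's `(T, e)` to the block frame's `(T′, e′)` (A-p01's ★ `transpose_pairFrame_mul_gram_mul_pairFrame` at `e`, then the permutation frame).
[cite: GelbartRogawski1991, §3.1 p. 454] [cite: MoeglinVignerasWaldspurger1987, Chap. 2 II Remarque (3)] -/
theorem transpose_pairPermFrame_mul_gram_mul_pairPermFrame (e e' : Fin N × Fin 1 ≃ Fin n) {T T' : Matrix (Fin N) (Fin N) F}
    (Q : GL (Fin N) F) (hQ : (Q : Matrix (Fin N) (Fin N) F)ᵀ * T * (Q : Matrix (Fin N) (Fin N) F) = T') (TW : Matrix (Fin 1) (Fin 1) F) :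
    ((UnitaryGroup.reindexGL e (kroneckerGL (Q, 1)) * permGL (e.symm.trans e') : GL (Fin n) F) : Matrix (Fin n) (Fin n) F)ᵀ *
          UnitaryDualPair.gram F e T TW *
        ((UnitaryGroup.reindexGL e (kroneckerGL (Q, 1)) * permGL (e.symm.trans e') : GL (Fin n) F) : Matrix (Fin n) (Fin n) F) =
      UnitaryDualPair.gram F e' T' TW := by
  rw [Units.val_mul]
  set R : Matrix (Fin n) (Fin n) F := ((UnitaryGroup.reindexGL e (kroneckerGL (Q, 1)) : GL (Fin n) F) : Matrix (Fin n) (Fin n) F) with hR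
  set Pσ : Matrix (Fin n) (Fin n) F := ((permGL (e.symm.trans e') : GL (Fin n) F) : Matrix (Fin n) (Fin n) F) with hPσ
  calc (R * Pσ)ᵀ * UnitaryDualPair.gram F e T TW * (R * Pσ) = Pσᵀ * (Rᵀ * UnitaryDualPair.gram F e T TW * R) * Pσ := by
        rw [Matrix.transpose_mul]; simp only [Matrix.mul_assoc]
    _ = UnitaryDualPair.gram F e' T' TW := by
        rw [hR, transpose_pairFrame_mul_gram_mul_pairFrame N e Q hQ TW, hPσ, transpose_permFrame_mul_gram_mul_permFrame]

/-- **columns of the two-enumeration pair frame**: `(Q_pair)_{i, e′(a, b)} = Q_{(e⁻¹ i)₁, a} · [ (e⁻¹ i)₂ = b ]` (the `Q`-formula the lead asked for; with a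
LINE `W`, `b = 0 = (e⁻¹ i)₂` and the Kronecker delta is `1`). [cite: GelbartRogawski1991, §3.1 p. 454] -/
theorem pairPermFrame_apply (e e' : Fin N × Fin 1 ≃ Fin n) (Q : GL (Fin N) F) (i : Fin n) (ab : Fin N × Fin 1) :
    ((UnitaryGroup.reindexGL e (kroneckerGL (Q, 1)) * permGL (e.symm.trans e') : GL (Fin n) F) : Matrix (Fin n) (Fin n) F) i (e' ab) =
      (Q : Matrix (Fin N) (Fin N) F) (e.symm i).1 ab.1 := by
  rw [Units.val_mul, coe_permGL, Equiv.Perm.permMatrix, PEquiv.mul_toMatrix_toPEquiv]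
  simp only [Matrix.submatrix_apply, id_eq, Equiv.symm_trans_apply, Equiv.symm_symm, Equiv.symm_apply_apply, UnitaryGroup.coe_reindexGL,
    coe_kroneckerGL, Units.val_one, Matrix.reindex_apply, Matrix.kroneckerMap_apply, Matrix.one_apply, if_pos (Subsingleton.elim _ _), mul_one]

/-- **(BD-gen) the pair Gram at the standard enumeration**: `gram (Equiv.prodUnique (Fin N) (Fin 1)) T_V (t) = t • T_V` — tensoring with a LINE `⟨t⟩`
rescales the Gram matrix. [cite: GelbartRogawski1991, §3.1 p. 454] -/
theorem gram_prodUnique (TV : Matrix (Fin N) (Fin N) F) (TW : Matrix (Fin 1) (Fin 1) F) :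
    UnitaryDualPair.gram F (Equiv.prodUnique (Fin N) (Fin 1)) TV TW = TW 0 0 • TV := by
  refine Matrix.ext fun i j => ?_
  simp only [UnitaryDualPair.gram, Matrix.reindex_apply, Matrix.submatrix_apply, Equiv.prodUnique_symm_apply, Matrix.kroneckerMap_apply,
    Matrix.smul_apply, smul_eq_mul, Fin.default_eq_zero]
  rw [mul_comm]

/-- **(BD-gen) the standard-enumeration pair Gram COMMUTES WITH BLOCK SUMS**: `gram pU (T₁ ⊕ᶠ T₂) T_W = gram pU T₁ T_W ⊕ᶠ gram pU T₂ T_W`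
(`pU = Equiv.prodUnique _ (Fin 1)`; ★ `UnitaryGroup.finSum N₁ N₂ J₁ J₂ = reindex (fromBlocks J₁ 0 0 J₂)`). [cite: Kudla1984, §1] [cite: GelbartRogawski1991, §3.1 p. 454] -/
theorem gram_prodUnique_finSum {N₁ N₂ : ℕ} (T₁ : Matrix (Fin N₁) (Fin N₁) F) (T₂ : Matrix (Fin N₂) (Fin N₂) F) (TW : Matrix (Fin 1) (Fin 1) F) :
    UnitaryDualPair.gram F (Equiv.prodUnique (Fin (N₁ + N₂)) (Fin 1)) (UnitaryGroup.finSum N₁ N₂ T₁ T₂) TW =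
      UnitaryGroup.finSum N₁ N₂ (UnitaryDualPair.gram F (Equiv.prodUnique (Fin N₁) (Fin 1)) T₁ TW)
        (UnitaryDualPair.gram F (Equiv.prodUnique (Fin N₂) (Fin 1)) T₂ TW) := by
  rw [gram_prodUnique, gram_prodUnique, gram_prodUnique, UnitaryGroup.finSum, UnitaryGroup.finSum,
    show Matrix.fromBlocks (TW 0 0 • T₁) 0 0 (TW 0 0 • T₂) = TW 0 0 • Matrix.fromBlocks T₁ 0 0 T₂ by rw [Matrix.fromBlocks_smul, smul_zero, smul_zero]]
  rfl

end Generic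

/-! ## §2 The CM block frame: (BD) the `hTsum` of (LS)∕(C4)∕(C5), the block facts, (PE∃) -/

section CM

variable (L : Type) [Field L] [NumberField L] [IsCMField L]
  (dV' : Fin 3 → L) (hdV' : ∀ i, IsCMField.complexConj L (dV' i) = dV' i) (ε : (↥(maximalRealSubfield L))ˣ)

/-- **(BD) THE PAIR GRAM OF THE BLOCK DATUM IS THE BLOCK SUM** `gram pU₃ (realDiagonal dV′) (ε) = gram pU₁ (realDiagonal (dV′₀)) (ε) ⊕ᶠ
gram pU₂ (realDiagonal (dV′₁, dV′₂)) (ε)` — the hypothesis `hTsum` of ★ (LS) `DoubledBlock.toRep_localSplittingCMWith_inlLoc_boxSB_of_eq` and of (C4)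
★ `exists_fibre_boxSB_eq_smul_blockFrame` at the block frame `(dV′, Equiv.prodUnique (Fin 3) (Fin 1))`, with the line block `T₁` EQUAL to the Gram matrix on
which ★ `lineWeilCM L (Equiv.prodUnique (Fin 1) (Fin 1)) (fun _ => dV′ 0) …` lives (A-p16's ★ `realDiagonal_eq_finSum` through `gram_prodUnique_finSum`).
[cite: Kudla1984, §1] [cite: GelbartRogawski1991, §3.2 p. 457] -/
theorem gram_prodUnique_realDiagonal_eq_finSum :
    UnitaryDualPair.gram (↥(maximalRealSubfield L)) (Equiv.prodUnique (Fin 3) (Fin 1)) (realDiagonal L dV' hdV') (TW (↥(maximalRealSubfield L)) ε) =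
      UnitaryGroup.finSum 1 2
        (UnitaryDualPair.gram (↥(maximalRealSubfield L)) (Equiv.prodUnique (Fin 1) (Fin 1)) (realDiagonal L (fun _ : Fin 1 => dV' 0) (fun _ => hdV' 0))
          (TW (↥(maximalRealSubfield L)) ε))
        (UnitaryDualPair.gram (↥(maximalRealSubfield L)) (Equiv.prodUnique (Fin 2) (Fin 1)) (realDiagonal L (fun k : Fin 2 => dV' k.succ) (fun k => hdV' k.succ))
          (TW (↥(maximalRealSubfield L)) ε)) := by
  rw [realDiagonal_eq_finSum L dV' hdV']
  exact gram_prodUnique_finSum (↥(maximalRealSubfield L)) _ _ _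

/-- **the line block is diagonal**: `gram pU₁ (realDiagonal (dV′₀)) (ε) = diagonal (fun _ => dV′₀ · ε)` — the hypothesis `hT₁t` of ★ (LS) (★ `gram_diagonal_TW`).
[cite: GelbartRogawski1991, §3.1 p. 454] -/
theorem gram_prodUnique_realDiagonal_one_eq_diagonal :
    UnitaryDualPair.gram (↥(maximalRealSubfield L)) (Equiv.prodUnique (Fin 1) (Fin 1)) (realDiagonal L (fun _ : Fin 1 => dV' 0) (fun _ => hdV' 0))
        (TW (↥(maximalRealSubfield L)) ε) =
      Matrix.diagonal fun _ : Fin 1 =>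
        (⟨dV' 0, (IsCMField.complexConj_eq_self_iff (K := L) (dV' 0)).1 (hdV' 0)⟩ : ↥(maximalRealSubfield L)) * ((ε : (↥(maximalRealSubfield L))ˣ) : ↥(maximalRealSubfield L)) := by
  unfold realDiagonal
  rw [gram_diagonal_TW]

/-- **the plane block is diagonal**: `gram pU₂ (realDiagonal (dV′₁, dV′₂)) (ε) = diagonal (k ↦ dV′_{k+1} · ε)`. [cite: GelbartRogawski1991, §3.1 p. 454] -/
theorem gram_prodUnique_realDiagonal_two_eq_diagonal :
    UnitaryDualPair.gram (↥(maximalRealSubfield L)) (Equiv.prodUnique (Fin 2) (Fin 1)) (realDiagonal L (fun k : Fin 2 => dV' k.succ) (fun k => hdV' k.succ))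
        (TW (↥(maximalRealSubfield L)) ε) =
      Matrix.diagonal fun k : Fin 2 =>
        (⟨dV' k.succ, (IsCMField.complexConj_eq_self_iff (K := L) (dV' k.succ)).1 (hdV' k.succ)⟩ : ↥(maximalRealSubfield L)) *
          ((ε : (↥(maximalRealSubfield L))ˣ) : ↥(maximalRealSubfield L)) := by
  unfold realDiagonal
  rw [gram_diagonal_TW]
  rfl

/-- the line block is symmetric (★ `isSymm_gram`). [cite: GelbartRogawski1991, §3.1 p. 454] -/
theorem isSymm_gram_prodUnique_realDiagonal_one :
    (UnitaryDualPair.gram (↥(maximalRealSubfield L)) (Equiv.prodUnique (Fin 1) (Fin 1)) (realDiagonal L (fun _ : Fin 1 => dV' 0) (fun _ => hdV' 0))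
        (TW (↥(maximalRealSubfield L)) ε)).IsSymm :=
  isSymm_gram (↥(maximalRealSubfield L)) _ (realDiagonal_isSymm L _ _) (isSymm_TW (↥(maximalRealSubfield L)) ε)

/-- the plane block is symmetric (★ `isSymm_gram`). [cite: GelbartRogawski1991, §3.1 p. 454] -/
theorem isSymm_gram_prodUnique_realDiagonal_two :
    (UnitaryDualPair.gram (↥(maximalRealSubfield L)) (Equiv.prodUnique (Fin 2) (Fin 1)) (realDiagonal L (fun k : Fin 2 => dV' k.succ) (fun k => hdV' k.succ))
        (TW (↥(maximalRealSubfield L)) ε)).IsSymm :=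
  isSymm_gram (↥(maximalRealSubfield L)) _ (realDiagonal_isSymm L _ _) (isSymm_TW (↥(maximalRealSubfield L)) ε)

variable (hdV'0 : ∀ i, dV' i ≠ 0)

include hdV'0 in
/-- the line block has unit determinant (★ `isUnit_det_gram`; the `hT₁` of (C4)). [cite: GelbartRogawski1991, §3.1 p. 454] -/
theorem isUnit_det_gram_prodUnique_realDiagonal_one :
    IsUnit (UnitaryDualPair.gram (↥(maximalRealSubfield L)) (Equiv.prodUnique (Fin 1) (Fin 1)) (realDiagonal L (fun _ : Fin 1 => dV' 0) (fun _ => hdV' 0))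
        (TW (↥(maximalRealSubfield L)) ε)).det :=
  isUnit_det_gram (↥(maximalRealSubfield L)) _ (isUnit_det_realDiagonal L _ _ fun _ => hdV'0 0) (isUnit_det_TW (↥(maximalRealSubfield L)) ε)

include hdV'0 in
/-- the plane block has unit determinant (★ `isUnit_det_gram`). [cite: GelbartRogawski1991, §3.1 p. 454] -/
theorem isUnit_det_gram_prodUnique_realDiagonal_two :
    IsUnit (UnitaryDualPair.gram (↥(maximalRealSubfield L)) (Equiv.prodUnique (Fin 2) (Fin 1)) (realDiagonal L (fun k : Fin 2 => dV' k.succ) (fun k => hdV' k.succ))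
        (TW (↥(maximalRealSubfield L)) ε)).det :=
  isUnit_det_gram (↥(maximalRealSubfield L)) _ (isUnit_det_realDiagonal L _ _ fun k => hdV'0 k.succ) (isUnit_det_TW (↥(maximalRealSubfield L)) ε)

omit hdV'0

/-- **(PE∃) THE PAIR FRAME BETWEEN TWO ENUMERATIONS, ∃-form** (the lead's 23:08:41Z refinement verbatim): a rational frame `P` of the hermitian space
(`Pᵀ · realDiagonal dV · P = realDiagonal dV′`) and two enumerations `e₁, e₁′ : Fin 3 × Fin 1 ≃ Fin n′` give a frame `Q ∈ GL_{n′}(L⁺)` of the PAIR space with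
`Qᵀ · gram e₁ (realDiagonal dV) (ε) · Q = gram e₁′ (realDiagonal dV′) (ε)`; witness `Q := reindexGL e₁ (P ⊗ 1) · permGL (e₁⁻¹ ∘ e₁′)` (`transpose_pairPermFrame_mul_gram_mul_pairPermFrame`).
[cite: GelbartRogawski1991, §3.1 p. 454] [cite: MoeglinVignerasWaldspurger1987, Chap. 2 II Remarque (3)] -/
theorem exists_pairFrame {n' : ℕ} (e₁ e₁' : Fin 3 × Fin 1 ≃ Fin n') (dV : Fin 3 → L) (hdV : ∀ i, IsCMField.complexConj L (dV i) = dV i)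
    (P : GL (Fin 3) ↥(maximalRealSubfield L))
    (hP : (P : Matrix (Fin 3) (Fin 3) ↥(maximalRealSubfield L))ᵀ * realDiagonal L dV hdV * (P : Matrix (Fin 3) (Fin 3) ↥(maximalRealSubfield L)) =
      realDiagonal L dV' hdV') :
    ∃ Q : GL (Fin n') ↥(maximalRealSubfield L),
      (Q : Matrix (Fin n') (Fin n') ↥(maximalRealSubfield L))ᵀ *
            UnitaryDualPair.gram (↥(maximalRealSubfield L)) e₁ (realDiagonal L dV hdV) (TW (↥(maximalRealSubfield L)) ε) *
          (Q : Matrix (Fin n') (Fin n') ↥(maximalRealSubfield L)) =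
        UnitaryDualPair.gram (↥(maximalRealSubfield L)) e₁' (realDiagonal L dV' hdV') (TW (↥(maximalRealSubfield L)) ε) :=
  ⟨UnitaryGroup.reindexGL e₁ (kroneckerGL (P, 1)) * permGL (e₁.symm.trans e₁'),
    transpose_pairPermFrame_mul_gram_mul_pairPermFrame (↥(maximalRealSubfield L)) e₁ e₁' P hP (TW (↥(maximalRealSubfield L)) ε)⟩

end CM

/-! ## §3 (BD-G) The group square at the block frame: `localLineInl_{pU} ∘ inlLoc^{V} = inlLoc^{V ⊗ W} ∘ localLineInl_{pU₁}` -/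

section GroupSquare

variable {F : Type} [Field F] [NumberField F] (E : Type) [Field E] [NumberField E] [Algebra F E] (c : E ≃ₐ[F] E)
  (w : HeightOneSpectrum (𝓞 F)) {N₁ N₂ : ℕ}
  {S₁ : Matrix (Fin N₁) (Fin N₁) F} {S₂ : Matrix (Fin N₂) (Fin N₂) F}
  {JV₁ : Matrix (Fin N₁) (Fin N₁) E} (hJV₁ : JV₁ = S₁.map (algebraMap F E))
  {JV : Matrix (Fin (N₁ + N₂)) (Fin (N₁ + N₂)) E} (hJV : JV = (UnitaryGroup.finSum N₁ N₂ S₁ S₂).map (algebraMap F E))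
  (JW : Matrix (Fin 1) (Fin 1) E) {T₁ : Matrix (Fin N₁) (Fin N₁) F} {T₂ : Matrix (Fin N₂) (Fin N₂) F}
  (hJ₁ : Matrix.reindex (Equiv.prodUnique (Fin N₁) (Fin 1)) (Equiv.prodUnique (Fin N₁) (Fin 1)) (JV₁ ⊗ₖ JW) = T₁.map (algebraMap F E))
  (hJ : Matrix.reindex (Equiv.prodUnique (Fin (N₁ + N₂)) (Fin 1)) (Equiv.prodUnique (Fin (N₁ + N₂)) (Fin 1)) (JV ⊗ₖ JW) =
    (UnitaryGroup.finSum N₁ N₂ T₁ T₂).map (algebraMap F E))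

/-- underlying family of `BlockSum.inlLoc g`: `GLn.piEquiv (reindex (GLn.piEquiv⁻¹ g ⊕ 1))` (definitional unfolding of ★ `BlockSum.inlLoc` = `localPiEquiv⁻¹ ∘ inlLocal ∘
localPiEquiv`). [cite: Kudla1984, §1] -/
theorem coe_inlLoc (g : localPi E c N₁ JV₁ w) :
    ((BlockSum.inlLoc F E c w N₁ N₂ hJV₁ hJV g : localPi E c (N₁ + N₂) JV w) : LocalGLPi E (N₁ + N₂) w) =
      localGLPiEquiv E (N₁ + N₂) w
        (UnitaryGroup.reindexGL (finSumFinEquiv : Fin N₁ ⊕ Fin N₂ ≃ Fin (N₁ + N₂))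
          (UnitaryGroup.blockDiagGL ((localGLPiEquiv E N₁ w).symm (g : LocalGLPi E N₁ w), 1))) :=
  rfl

/-- **(BD-G) THE GROUP SQUARE AT THE BLOCK FRAME** (generic `F ⊂ E`, blocks `N₁ + N₂`, a LINE `W`, the standard enumerations `pU := Equiv.prodUnique _ (Fin 1)`):
for `g₁ ∈ U(J_{V₁})(F_w)`, `localLineInl_{pU} (g₁ ⊕ 1) = (localLineInl_{pU₁} g₁) ⊕ 1` — the first member of the dual pair with a line commutes with the block
embedding of the see-saw `U(V₁) × U(V₂) ⊂ U(V₁ ⊕ V₂)` (both sides are the family `𝔴 ↦ g₁,𝔴 ⊕ 1` relabelled). No cast: the two `hJ`'s are equalities of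
`Fin (N₁ + N₂)`-matrices. [cite: Kudla1984, §1] [cite: MoeglinVignerasWaldspurger1987, Chap. 1 I.17; Chap. 2 II.1 Rem. (6)] [cite: GelbartRogawski1991, §3.2 p. 457] -/
theorem localLineInl_prodUnique_inlLoc (g₁ : localPi E c N₁ JV₁ w) :
    localLineInl E c (N₁ + N₂) (Equiv.prodUnique (Fin (N₁ + N₂)) (Fin 1)) JV JW w (BlockSum.inlLoc F E c w N₁ N₂ hJV₁ hJV g₁) =
      BlockSum.inlLoc F E c w N₁ N₂ hJ₁ hJ (localLineInl E c N₁ (Equiv.prodUnique (Fin N₁) (Fin 1)) JV₁ JW w g₁) := by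
  refine Subtype.ext (funext fun 𝔴 => Units.ext (Matrix.ext fun a b => ?_))
  rw [coe_localLineInl, coe_localLineGL_apply, coe_inlLoc, coe_inlLoc, coe_localLineInl]
  simp only [GLn.coe_piEquiv_apply, Matrix.map_apply, Pi.evalRingHom_apply, UnitaryGroup.coe_reindexGL, Matrix.reindex_apply, Matrix.submatrix_apply,
    Equiv.prodUnique_symm_apply, Matrix.kroneckerMap_apply, Matrix.one_apply, if_true, mul_one, UnitaryGroup.coe_blockDiagGL]
  rcases finSumFinEquiv.symm a with x | x <;> rcases finSumFinEquiv.symm b with y | y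
  · simp only [Matrix.fromBlocks_apply₁₁, GLn.coe_piEquiv_symm_apply, coe_localLineGL_apply, Matrix.reindex_apply, Matrix.submatrix_apply,
      Equiv.prodUnique_symm_apply, Matrix.kroneckerMap_apply, Matrix.one_apply, if_true, mul_one]
  · simp only [Matrix.fromBlocks_apply₁₂, Matrix.zero_apply, Pi.zero_apply]
  · simp only [Matrix.fromBlocks_apply₂₁, Matrix.zero_apply, Pi.zero_apply]
  · simp only [Matrix.fromBlocks_apply₂₂, Units.val_one, Matrix.one_apply]

end GroupSquare

section CMSquare

variable (L : Type) [Field L] [NumberField L] [IsCMField L] (v : HeightOneSpectrum (𝓞 ↥(maximalRealSubfield L)))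
  (dV' : Fin 3 → L) (hdV' : ∀ i, IsCMField.complexConj L (dV' i) = dV' i) (ε : (↥(maximalRealSubfield L))ˣ)

/-- **the pair-level `hJ₁` at the block frame**: `reindex pU₁ pU₁ (diag(dV′₀) ⊗ₖ J_W(ε)) = T₁ ⊗ 1` with `T₁ = gram pU₁ (realDiagonal (dV′₀)) (ε)`
(★ `reindex_kronecker_eq_gram_map`). [cite: GelbartRogawski1991, §3.1 p. 454] -/
theorem reindex_prodUnique_kronecker_one_eq_gram_map :
    Matrix.reindex (Equiv.prodUnique (Fin 1) (Fin 1)) (Equiv.prodUnique (Fin 1) (Fin 1))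
        ((Matrix.diagonal fun _ : Fin 1 => dV' 0) ⊗ₖ JW (↥(maximalRealSubfield L)) L ε) =
      (UnitaryDualPair.gram (↥(maximalRealSubfield L)) (Equiv.prodUnique (Fin 1) (Fin 1)) (realDiagonal L (fun _ : Fin 1 => dV' 0) (fun _ => hdV' 0))
        (TW (↥(maximalRealSubfield L)) ε)).map (algebraMap (↥(maximalRealSubfield L)) L) :=
  reindex_kronecker_eq_gram_map (↥(maximalRealSubfield L)) L _ (realDiagonal_map L _ _).symm (JW_eq (↥(maximalRealSubfield L)) L ε)

/-- **the pair-level `hJ` at the block frame**: `reindex pU₃ pU₃ (diag(dV′) ⊗ₖ J_W(ε)) = (T₁ ⊕ᶠ T₂) ⊗ 1` (★ `reindex_kronecker_eq_gram_map` + (BD)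
`gram_prodUnique_realDiagonal_eq_finSum`) — the hypothesis of the pair-level ★ `BlockSum.inlLoc` that ★ (LS) `toRep_localSplittingCMWith_inlLoc_boxSB_of_eq` consumes.
[cite: Kudla1984, §1] [cite: GelbartRogawski1991, §3.1 p. 454] -/
theorem reindex_prodUnique_kronecker_three_eq_finSum_map :
    Matrix.reindex (Equiv.prodUnique (Fin 3) (Fin 1)) (Equiv.prodUnique (Fin 3) (Fin 1)) (Matrix.diagonal dV' ⊗ₖ JW (↥(maximalRealSubfield L)) L ε) =
      (UnitaryGroup.finSum 1 2
        (UnitaryDualPair.gram (↥(maximalRealSubfield L)) (Equiv.prodUnique (Fin 1) (Fin 1)) (realDiagonal L (fun _ : Fin 1 => dV' 0) (fun _ => hdV' 0))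
          (TW (↥(maximalRealSubfield L)) ε))
        (UnitaryDualPair.gram (↥(maximalRealSubfield L)) (Equiv.prodUnique (Fin 2) (Fin 1)) (realDiagonal L (fun k : Fin 2 => dV' k.succ) (fun k => hdV' k.succ))
          (TW (↥(maximalRealSubfield L)) ε))).map (algebraMap (↥(maximalRealSubfield L)) L) := by
  rw [← gram_prodUnique_realDiagonal_eq_finSum L dV' hdV' ε]
  exact reindex_kronecker_eq_gram_map (↥(maximalRealSubfield L)) L _ (realDiagonal_map L dV' hdV').symm (JW_eq (↥(maximalRealSubfield L)) L ε)

/-- **(BD-G) THE GROUP SQUARE AT THE CM BLOCK FRAME, free block Grams** (`N = 3 = 1 + 2`, line `⟨ε⟩`, V-level `hJ`'s = A-p16's ★ `realDiagonal_map`∕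
`diagonal_eq_finSum_realDiagonal_map`, pair-level `hJ₁ hJ` ARBITRARY): `localLineInl_{pU₃} (inlLoc^{V} g₁) = inlLoc^{V ⊗ W} (localLineInl_{pU₁} g₁)` for every
`g₁ ∈ U(diag(dV′₀))(L⁺_v)` — the step «`ch t = BlockSum.inlLoc … β̃`» of (C5) between ★ (BF)(i) and ★ (LS). [cite: Kudla1984, §1] [cite: GelbartRogawski1991, §3.2 p. 457] -/
theorem localLineInl_prodUnique_inlLoc_cm {T₁ : Matrix (Fin 1) (Fin 1) ↥(maximalRealSubfield L)} {T₂ : Matrix (Fin 2) (Fin 2) ↥(maximalRealSubfield L)}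
    (hJ₁ : Matrix.reindex (Equiv.prodUnique (Fin 1) (Fin 1)) (Equiv.prodUnique (Fin 1) (Fin 1))
        ((Matrix.diagonal fun _ : Fin 1 => dV' 0) ⊗ₖ JW (↥(maximalRealSubfield L)) L ε) = T₁.map (algebraMap (↥(maximalRealSubfield L)) L))
    (hJ : Matrix.reindex (Equiv.prodUnique (Fin 3) (Fin 1)) (Equiv.prodUnique (Fin 3) (Fin 1)) (Matrix.diagonal dV' ⊗ₖ JW (↥(maximalRealSubfield L)) L ε) =
        (UnitaryGroup.finSum 1 2 T₁ T₂).map (algebraMap (↥(maximalRealSubfield L)) L))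
    (g₁ : localPi L (IsCMField.complexConj L) 1 (Matrix.diagonal fun _ : Fin 1 => dV' 0) v) :
    localLineInl L (IsCMField.complexConj L) 3 (Equiv.prodUnique (Fin 3) (Fin 1)) (Matrix.diagonal dV') (JW (↥(maximalRealSubfield L)) L ε) v
        (BlockSum.inlLoc (↥(maximalRealSubfield L)) L (IsCMField.complexConj L) v 1 2
          (realDiagonal_map L (fun _ : Fin 1 => dV' 0) (fun _ => hdV' 0)).symm (diagonal_eq_finSum_realDiagonal_map L dV' hdV') g₁) =
      BlockSum.inlLoc (↥(maximalRealSubfield L)) L (IsCMField.complexConj L) v 1 2 hJ₁ hJ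
        (localLineInl L (IsCMField.complexConj L) 1 (Equiv.prodUnique (Fin 1) (Fin 1)) (Matrix.diagonal fun _ : Fin 1 => dV' 0)
          (JW (↥(maximalRealSubfield L)) L ε) v g₁) := by
  -- same entrywise computation as `localLineInl_prodUnique_inlLoc` (instantiating it at `N₁ + N₂ = 3` by `exact` is an expensive `isDefEq`)
  refine Subtype.ext (funext fun 𝔴 => Units.ext (Matrix.ext fun a b => ?_))
  rw [coe_localLineInl, coe_localLineGL_apply, coe_inlLoc, coe_inlLoc, coe_localLineInl]
  simp only [GLn.coe_piEquiv_apply, Matrix.map_apply, Pi.evalRingHom_apply, UnitaryGroup.coe_reindexGL, Matrix.reindex_apply, Matrix.submatrix_apply,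
    Equiv.prodUnique_symm_apply, Matrix.kroneckerMap_apply, Matrix.one_apply, if_true, mul_one, UnitaryGroup.coe_blockDiagGL]
  rcases (finSumFinEquiv : Fin 1 ⊕ Fin 2 ≃ Fin (1 + 2)).symm a with x | x <;> rcases (finSumFinEquiv : Fin 1 ⊕ Fin 2 ≃ Fin (1 + 2)).symm b with y | y
  · simp only [Matrix.fromBlocks_apply₁₁, GLn.coe_piEquiv_symm_apply, coe_localLineGL_apply, Matrix.reindex_apply, Matrix.submatrix_apply,
      Equiv.prodUnique_symm_apply, Matrix.kroneckerMap_apply, Matrix.one_apply, if_true, mul_one]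
  · simp only [Matrix.fromBlocks_apply₁₂, Matrix.zero_apply, Pi.zero_apply]
  · simp only [Matrix.fromBlocks_apply₂₁, Matrix.zero_apply, Pi.zero_apply]
  · simp only [Matrix.fromBlocks_apply₂₂, Units.val_one, Matrix.one_apply]

/-- **(BD-G) THE GROUP SQUARE AT THE CM BLOCK FRAME, of record** — pair-level blocks `T₁ := gram pU₁ (realDiagonal (dV′₀)) (ε)`, `T₂ := gram pU₂ (realDiagonal
(dV′₁, dV′₂)) (ε)` and their `hJ₁`, `hJ` from this file: `localLineInl_{pU₃} (inlLoc^{V} g₁) = inlLoc^{V ⊗ W} (localLineInl_{pU₁} g₁)`.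
[cite: Kudla1984, §1] [cite: GelbartRogawski1991, §3.2 p. 457] -/
theorem localLineInl_prodUnique_inlLoc_blockFrame (g₁ : localPi L (IsCMField.complexConj L) 1 (Matrix.diagonal fun _ : Fin 1 => dV' 0) v) :
    localLineInl L (IsCMField.complexConj L) 3 (Equiv.prodUnique (Fin 3) (Fin 1)) (Matrix.diagonal dV') (JW (↥(maximalRealSubfield L)) L ε) v
        (BlockSum.inlLoc (↥(maximalRealSubfield L)) L (IsCMField.complexConj L) v 1 2
          (realDiagonal_map L (fun _ : Fin 1 => dV' 0) (fun _ => hdV' 0)).symm (diagonal_eq_finSum_realDiagonal_map L dV' hdV') g₁) =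
      BlockSum.inlLoc (↥(maximalRealSubfield L)) L (IsCMField.complexConj L) v 1 2
        (reindex_prodUnique_kronecker_one_eq_gram_map L dV' hdV' ε) (reindex_prodUnique_kronecker_three_eq_finSum_map L dV' hdV' ε)
        (localLineInl L (IsCMField.complexConj L) 1 (Equiv.prodUnique (Fin 1) (Fin 1)) (Matrix.diagonal fun _ : Fin 1 => dV' 0)
          (JW (↥(maximalRealSubfield L)) L ε) v g₁) :=
  localLineInl_prodUnique_inlLoc_cm L v dV' hdV' ε _ _ g₁

end CMSquare

end Summit.HodgeConjecture.HodgeConjecture.Cruxes.H413.F0P2oCMBlockFrameGram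

end
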